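import Summits.ValiantsHypothesis.ValiantsHypothesis.Theorems.KPlusLogSqLawMixedGaugeTwoClassRatioThree
import Summits.ValiantsHypothesis.ValiantsHypothesis.Theorems.KPlusLogSqLawMixedGaugeCubeLoewnerIntegrals

/-!
# Route «KPlusLogSqLaw», `WeakLifting` (stmt-ValiantsHypothesis-19561) — the CUBE-ROOT LOEWNER KERNEL is positive definite, and
# THE TWO-CLASS LAW at ratio 3 becomes unconditional: `ζ ≤ n + 2m`

HONEST FRAMING.  Helper file (seat val-sym-lift-p4 g26, cell `pub-symmetroid`, 2026-08-29; `--supports 19561 --as helper`, zero crux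
credit), sixth of the seat's mixed-gauge series.  (1) `cubeLoewner_form_eq_integral`: for positive `xⱼ` and real `cⱼ`,
`I · Σⱼₗ cⱼcₗ/(xⱼ² + xⱼxₗ + xₗ²) = ∫₀^∞ μ³ (Σⱼ cⱼ/(xⱼ³ + μ³))² dμ` (`I = ∫₀^∞ ds/(1+s³) > 0`, from `MixedGauge.integral_pair`); hence
`cubeLoewner_nonneg` and — through the non-vanishing of the rational function `Σⱼ cⱼ/(xⱼ³ + t)` for `c ≠ 0` and distinct `xⱼ`
(`exists_sum_div_ne_zero`, Lagrange evaluation of the polynomial `Σⱼ cⱼ ∏_{l≠j}(xₗ³ + X)` at `−xⱼ³`) — STRICT positive definiteness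
`cubeLoewner_posDef`, which is literally the hypothesis `hK` of `MixedGauge.card_posZeros_le_blocks_of_cubeLoewner`.  (2) THE TWO-CLASS
LAW AT RATIO 3, UNCONDITIONAL (`card_posZeros_le_blocks`, `card_posRoots_det_blockPencil_le`): for `A ∈ Sym(n)`, `C ∈ Sym(m)`, any real
`n × m` matrix `B` and `a ≥ 1`, the determinant of `[[A + X^a·1, B], [Bᵀ, C − X^{3a}·1]]` has at most `n + 2m` distinct positive roots
(`n` slow positive diagonal monomials, `m` fast negative ones, one constant symmetric letter; Descartes' count ≈ `n + 3m`; the located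
maximum IS `n + 2m`, memo MIXED-GAUGE-LAW.md).  Nothing here is about `WeakLifting` / `TropicalB` in their windows, the doors,
`MatrixDescartes` (18050) or VP ≠ VNP.  No `def`; axioms standard.  [Löwner 1934 / Heinz 1951 for the kernel; folklore calculus]
-/

set_option linter.dupNamespace false
set_option autoImplicit false

namespace Summit.ValiantsHypothesis.ValiantsHypothesis.Theorems.KPlusLogSqLaw

open MeasureTheory Set Filter Topology Matrix Finset
open scoped BigOperators

namespace MixedGauge

variable {n m : ℕ}

/-! ## 1. The Gram integral of the cube-root Loewner form -/

/-- `I · Σⱼₗ cⱼ cₗ /(xⱼ² + xⱼxₗ + xₗ²) = ∫_{(0,∞)} μ³ (Σⱼ cⱼ/(xⱼ³ + μ³))² dμ`. -/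
theorem cubeLoewner_form_eq_integral {k : ℕ} (x c : Fin k → ℝ) (hx : ∀ i, 0 < x i) :
    (∫ s in Ioi (0:ℝ), 1 / (1 + s ^ 3)) * ∑ j, ∑ l, c j * c l / (x j ^ 2 + x j * x l + x l ^ 2) =
      ∫ μ in Ioi (0:ℝ), μ ^ 3 * (∑ j, c j / (x j ^ 3 + μ ^ 3)) ^ 2 := by
  -- pointwise: μ³ (Σ cⱼ/(xⱼ³+μ³))² = Σⱼₗ cⱼcₗ μ³/((xⱼ³+μ³)(xₗ³+μ³))
  have hpt : ∀ μ ∈ Ioi (0:ℝ), μ ^ 3 * (∑ j, c j / (x j ^ 3 + μ ^ 3)) ^ 2 =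
      ∑ j, ∑ l, c j * c l * (μ ^ 3 / ((x j ^ 3 + μ ^ 3) * (x l ^ 3 + μ ^ 3))) := by
    intro μ hμ
    have hμ' : 0 < μ := hμ
    rw [pow_two, Finset.sum_mul_sum, Finset.mul_sum]
    refine Finset.sum_congr rfl fun j _ => ?_
    rw [Finset.mul_sum]
    refine Finset.sum_congr rfl fun l _ => ?_
    have h1 : x j ^ 3 + μ ^ 3 ≠ 0 := by have := hx j; positivity
    have h2 : x l ^ 3 + μ ^ 3 ≠ 0 := by have := hx l; positivity
    field_simp
  rw [setIntegral_congr_fun measurableSet_Ioi hpt]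
  have hint : ∀ j l, IntegrableOn (fun μ : ℝ => c j * c l * (μ ^ 3 / ((x j ^ 3 + μ ^ 3) * (x l ^ 3 + μ ^ 3)))) (Ioi 0) :=
    fun j l => (integrableOn_pair (x j) (x l) (hx j) (hx l)).const_mul (c j * c l)
  rw [integral_finsetSum _ (fun j _ => integrable_finsetSum _ (fun l _ => hint j l))]
  simp_rw [integral_finsetSum _ (fun l _ => hint _ l), integral_const_mul]
  rw [Finset.mul_sum]
  refine Finset.sum_congr rfl fun j _ => ?_
  rw [Finset.mul_sum]
  refine Finset.sum_congr rfl fun l _ => ?_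
  rw [integral_pair (x j) (x l) (hx j) (hx l)]
  have hq : x j ^ 2 + x j * x l + x l ^ 2 ≠ 0 := by have := hx j; have := hx l; positivity
  field_simp

/-- **The cube-root Loewner form is non-negative**: `0 ≤ Σⱼₗ cⱼ cₗ/(xⱼ² + xⱼxₗ + xₗ²)` for positive `xⱼ`. -/
theorem cubeLoewner_nonneg {k : ℕ} (x c : Fin k → ℝ) (hx : ∀ i, 0 < x i) :
    0 ≤ ∑ j, ∑ l, c j * c l / (x j ^ 2 + x j * x l + x l ^ 2) := by
  have hI := I_pos
  have h := cubeLoewner_form_eq_integral x c hx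
  have hnn : 0 ≤ ∫ μ in Ioi (0:ℝ), μ ^ 3 * (∑ j, c j / (x j ^ 3 + μ ^ 3)) ^ 2 :=
    setIntegral_nonneg measurableSet_Ioi fun μ hμ => by
      have : (0:ℝ) < μ := hμ
      positivity
  rw [← h] at hnn
  exact nonneg_of_mul_nonneg_right hnn hI

/-! ## 2. Strictness: the rational function `Σ cⱼ/(xⱼ³ + t)` does not vanish identically -/

/-- for pairwise distinct positive `xⱼ` and `c ≠ 0` there is `μ > 0` with `Σⱼ cⱼ/(xⱼ³ + μ³) ≠ 0`. -/
theorem exists_sum_div_ne_zero {k : ℕ} (x c : Fin k → ℝ) (hx : ∀ i, 0 < x i) (hinj : Function.Injective x)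
    (hc : c ≠ 0) : ∃ μ : ℝ, 0 < μ ∧ ∑ j, c j / (x j ^ 3 + μ ^ 3) ≠ 0 := by
  classical
  by_contra hall
  push Not at hall
  -- the Lagrange-type polynomial P = Σⱼ cⱼ ∏_{l ≠ j} (xₗ³ + X)
  let P : Polynomial ℝ := ∑ j, Polynomial.C (c j) * ∏ l ∈ Finset.univ.erase j, (Polynomial.C (x l ^ 3) + Polynomial.X)
  have hevalP : ∀ t : ℝ, P.eval t = ∑ j, c j * ∏ l ∈ Finset.univ.erase j, (x l ^ 3 + t) := by
    intro t
    simp only [P, Polynomial.eval_finsetSum, Polynomial.eval_mul, Polynomial.eval_C, Polynomial.eval_prod,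
      Polynomial.eval_add, Polynomial.eval_X]
  -- P vanishes on (0,∞)
  have hroot : ∀ t : ℝ, 0 < t → P.eval t = 0 := by
    intro t ht
    set μ : ℝ := t ^ ((3:ℕ)⁻¹ : ℝ) with hμdef
    have hμpos : 0 < μ := Real.rpow_pos_of_pos ht _
    have hμ3 : μ ^ 3 = t := by
      rw [hμdef]; exact Real.rpow_inv_natCast_pow ht.le three_ne_zero
    have hsum := hall μ hμpos
    rw [hμ3] at hsum
    rw [hevalP]
    have hprod : ∀ j, c j * ∏ l ∈ Finset.univ.erase j, (x l ^ 3 + t) =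
        (∏ l, (x l ^ 3 + t)) * (c j / (x j ^ 3 + t)) := by
      intro j
      have hj : x j ^ 3 + t ≠ 0 := by have := hx j; positivity
      rw [← Finset.prod_erase_mul (Finset.univ) (fun l => x l ^ 3 + t) (Finset.mem_univ j)]
      field_simp
    simp_rw [hprod, ← Finset.mul_sum, hsum, mul_zero]
  have hP0 : P = 0 := by
    apply Polynomial.eq_zero_of_infinite_isRoot
    exact (Set.Ioi_infinite (0:ℝ)).mono fun t ht => hroot t ht
  -- evaluate at −xⱼ³: cⱼ ∏_{l≠j}(xₗ³ − xⱼ³) = 0, so cⱼ = 0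
  have hcj : ∀ j, c j = 0 := by
    intro j
    have h := hevalP (-(x j ^ 3))
    rw [hP0, Polynomial.eval_zero] at h
    have hsplit := (Finset.sum_erase_add (Finset.univ) (fun j' => c j' * ∏ l ∈ Finset.univ.erase j', (x l ^ 3 + -(x j ^ 3)))
      (Finset.mem_univ j)).symm
    rw [hsplit] at h
    have hothers : ∑ j' ∈ Finset.univ.erase j, c j' * ∏ l ∈ Finset.univ.erase j', (x l ^ 3 + -(x j ^ 3)) = 0 := by
      refine Finset.sum_eq_zero fun j' hj' => ?_
      have hne : j' ≠ j := (Finset.mem_erase.mp hj').1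
      rw [Finset.prod_eq_zero (Finset.mem_erase.mpr ⟨hne.symm, Finset.mem_univ j⟩) (by ring), mul_zero]
    rw [hothers, zero_add] at h
    have hprod : ∏ l ∈ Finset.univ.erase j, (x l ^ 3 + -(x j ^ 3)) ≠ 0 := by
      rw [Finset.prod_ne_zero_iff]
      intro l hl
      have hne : l ≠ j := (Finset.mem_erase.mp hl).1
      intro h0
      have h3 : x l ^ 3 = x j ^ 3 := by linarith
      have := (pow_left_inj₀ (hx l).le (hx j).le three_ne_zero).mp h3
      exact hne (hinj this)
    exact (mul_eq_zero.mp h.symm).resolve_right hprod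
  exact hc (funext hcj)

/-- **The cube-root Loewner kernel is positive definite**: for pairwise distinct positive `xⱼ` and `c ≠ 0`,
`0 < Σⱼ Σₗ cⱼ cₗ /(xⱼ² + xⱼxₗ + xₗ²)` — the Loewner matrix of `t ↦ t^{1/3}` at the points `xⱼ³` (Löwner–Heinz), here by the Gram
integral `1/(x²+xy+y²) = I⁻¹ ∫₀^∞ μ³ dμ/((x³+μ³)(y³+μ³))`. -/
theorem cubeLoewner_posDef (k : ℕ) (x c : Fin k → ℝ) (hx : ∀ i, 0 < x i) (hinj : Function.Injective x) (hc : c ≠ 0) :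
    0 < ∑ j, ∑ l, c j * c l / (x j ^ 2 + x j * x l + x l ^ 2) := by
  have hI := I_pos
  have h := cubeLoewner_form_eq_integral x c hx
  -- the integrand is continuous on (0,∞), non-negative, and positive somewhere
  obtain ⟨μ₀, hμ₀, hR⟩ := exists_sum_div_ne_zero x c hx hinj hc
  let g : ℝ → ℝ := fun μ => μ ^ 3 * (∑ j, c j / (x j ^ 3 + μ ^ 3)) ^ 2
  have hgint : IntegrableOn g (Ioi 0) := by
    have hpt : ∀ μ ∈ Ioi (0:ℝ), g μ = ∑ j, ∑ l, c j * c l * (μ ^ 3 / ((x j ^ 3 + μ ^ 3) * (x l ^ 3 + μ ^ 3))) := by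
      intro μ hμ
      have hμ' : 0 < μ := hμ
      simp only [g]
      rw [pow_two, Finset.sum_mul_sum, Finset.mul_sum]
      refine Finset.sum_congr rfl fun j _ => ?_
      rw [Finset.mul_sum]
      refine Finset.sum_congr rfl fun l _ => ?_
      have h1 : x j ^ 3 + μ ^ 3 ≠ 0 := by have := hx j; positivity
      have h2 : x l ^ 3 + μ ^ 3 ≠ 0 := by have := hx l; positivity
      field_simp
    refine IntegrableOn.congr_fun ?_ (fun μ hμ => (hpt μ hμ).symm) measurableSet_Ioi
    exact integrable_finsetSum _ fun j _ => integrable_finsetSum _ fun l _ =>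
      (integrableOn_pair (x j) (x l) (hx j) (hx l)).const_mul (c j * c l)
  have hgpos : 0 < ∫ μ in Ioi (0:ℝ), g μ := by
    rw [setIntegral_pos_iff_support_of_nonneg_ae ?_ hgint]
    · -- the support contains a neighbourhood of μ₀ within (0,∞)
      have hg0 : 0 < g μ₀ := by
        simp only [g]
        have : 0 < (∑ j, c j / (x j ^ 3 + μ₀ ^ 3)) ^ 2 := by positivity
        positivity
      have hcontOn : ContinuousOn g (Ioi 0) := by
        refine ContinuousOn.mul (by fun_prop) (ContinuousOn.pow ?_ 2)
        refine continuousOn_finsetSum _ fun j _ => ?_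
        refine ContinuousOn.div continuousOn_const (by fun_prop) ?_
        intro μ hμ
        have : (0:ℝ) < μ := hμ
        have := hx j
        positivity
      have hcont : ContinuousAt g μ₀ := hcontOn.continuousAt (Ioi_mem_nhds hμ₀)
      have hev : ∀ᶠ μ in 𝓝 μ₀, 0 < g μ := hcont.eventually (lt_mem_nhds hg0)
      obtain ⟨ε, hε, hball⟩ := Metric.eventually_nhds_iff.mp hev
      let δ : ℝ := min ε μ₀ / 2
      have hδ : 0 < δ := by positivity
      have hsub : Ioo (μ₀ - δ) (μ₀ + δ) ⊆ Function.support g ∩ Ioi 0 := by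
        intro μ hμ
        rw [Set.mem_Ioo] at hμ
        have hδε : δ < ε := by
          have : min ε μ₀ ≤ ε := min_le_left _ _
          simp only [δ]; linarith
        have hδμ : δ < μ₀ := by
          have : min ε μ₀ ≤ μ₀ := min_le_right _ _
          simp only [δ]; linarith
        refine ⟨?_, ?_⟩
        · have : 0 < g μ := hball (by rw [Real.dist_eq, abs_lt]; constructor <;> linarith)
          exact ne_of_gt this
        · show 0 < μ
          linarith
      calc (0 : ENNReal) < volume (Ioo (μ₀ - δ) (μ₀ + δ)) := by
            rw [Real.volume_Ioo]; exact ENNReal.ofReal_pos.mpr (by linarith)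
        _ ≤ volume (Function.support g ∩ Ioi 0) := measure_mono hsub
    · rw [EventuallyLE, ae_restrict_iff' measurableSet_Ioi]
      exact Filter.Eventually.of_forall fun μ hμ => by
        have : (0:ℝ) < μ := hμ
        simp only [Pi.zero_apply, g]
        positivity
  have hprod : 0 < (∫ s in Ioi (0:ℝ), 1 / (1 + s ^ 3)) * ∑ j, ∑ l, c j * c l / (x j ^ 2 + x j * x l + x l ^ 2) := by
    rw [h]; exact hgpos
  exact pos_of_mul_pos_right hprod hI.le

/-! ## 3. The two-class law at ratio 3, unconditional -/

/-- **THE TWO-CLASS LAW at ratio 3.**  `A ∈ Sym(n)`, `C ∈ Sym(m)`, `B` any real `n × m` matrix, `1 ≤ a`: a finite set of positive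
`x`, each carrying a non-zero kernel vector of `[[A + x^a·1, B], [Bᵀ, C − x^{3a}·1]]`, has at most `n + 2m` elements. -/
theorem card_posZeros_le_blocks (A : Matrix (Fin n) (Fin n) ℝ) (hA : A.IsSymm) (C : Matrix (Fin m) (Fin m) ℝ) (hC : C.IsSymm)
    (B : Matrix (Fin n) (Fin m) ℝ) (a : ℕ) (ha : 1 ≤ a) (S : Finset ℝ)
    (hS : ∀ x ∈ S, 0 < x ∧ ∃ w : Fin n → ℝ, ∃ q : Fin m → ℝ, (w ≠ 0 ∨ q ≠ 0) ∧
      (A + (x ^ a) • (1 : Matrix (Fin n) (Fin n) ℝ)) *ᵥ w + B *ᵥ q = 0 ∧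
      Bᵀ *ᵥ w + (C - (x ^ (3 * a)) • (1 : Matrix (Fin m) (Fin m) ℝ)) *ᵥ q = 0) :
    S.card ≤ n + 2 * m :=
  card_posZeros_le_blocks_of_cubeLoewner cubeLoewner_posDef A hA C hC B a ha S hS

/-- **THE TWO-CLASS LAW at ratio 3, determinant currency.**  For `A ∈ Sym(n)`, `C ∈ Sym(m)`, any real `B`, `1 ≤ a`: the determinant of
the block lacunary pencil `[[A + X^a·1, B], [Bᵀ, C − X^{3a}·1]]` — `n` slow positive diagonal monomials, `m` fast negative ones, one
constant symmetric letter — has at most `n + 2m` distinct positive real roots. -/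
theorem card_posRoots_det_blockPencil_le (A : Matrix (Fin n) (Fin n) ℝ) (hA : A.IsSymm) (C : Matrix (Fin m) (Fin m) ℝ)
    (hC : C.IsSymm) (B : Matrix (Fin n) (Fin m) ℝ) (a : ℕ) (ha : 1 ≤ a) :
    ((Matrix.det (Matrix.fromBlocks (A.map Polynomial.C + ((Polynomial.X : Polynomial ℝ) ^ a) • 1) (B.map Polynomial.C)
          (Bᵀ.map Polynomial.C)
          (C.map Polynomial.C - ((Polynomial.X : Polynomial ℝ) ^ (3 * a)) • 1))).roots.toFinset.filter
        (fun x => 0 < x)).card ≤ n + 2 * m :=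
  card_posRoots_det_blockPencil_le_of_cubeLoewner cubeLoewner_posDef A hA C hC B a ha

end MixedGauge

end Summit.ValiantsHypothesis.ValiantsHypothesis.Theorems.KPlusLogSqLaw
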